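import Literature.AlgebraicGeometry.Motives.AbelianVarietyTorsion
import Literature.NumberTheory.DiophantineGeometry.CorepGroupLaw
import Literature.NumberTheory.DiophantineGeometry.FiniteGroupSchemeOrder
import HarnessLib

/-!
# The kernel of an isogeny is killed by its order; quasi-inverses of isogenies

This file discharges the last named input of the decomposition
(`Literature/NumberTheory/DiophantineGeometry/AVIsogenyQuasiInverse.lean`) of the classical fact
`Literature.AlgebraicGeometry.Motives.AbelianVariety.IsIsogeny.exists_nsmul_inverse` (an isogeny `f : A → B` of abelian varieties
over a field `K` has a quasi-inverse `g` with `g ∘ f = [n]_A`, `f ∘ g = [n]_B`, `n ≥ 1`; Mumford,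
*Abelian Varieties*, §19, Remark p. 169; Görtz–Wedhorn, *Algebraic Geometry II*, Prop. 27.190),
namely `IsIsogeny.exists_kerPoints_le_nsmul`: **the kernel of an isogeny is annihilated by a positive
integer** `n`, here `n = deg f = dim_K Γ(Ker f, 𝒪)` (`Hom.kerRank f`), the order of the finite group
scheme `Ker f` (Görtz–Wedhorn II, Prop. 27.86 (Deligne's theorem) with Cor. 27.177), and assembles
the final theorem `IsIsogeny.exists_nsmul_inverse_holds`.

## The proof

Let `f : A → B` be a homomorphism with finite underlying morphism (e.g. an isogeny) and let
`H = Γ(Ker f, 𝒪)` be the affine algebra of its (finite, hence affine) scheme-theoretic kernel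
`Ker f = A ×_{B, e} Spec K` (`Hom.ker`, from `AVIsogenyFlat`), a finite `K`-algebra.

1. *Points.* For every commutative `K`-algebra `R'`, the `Spec R'`-valued points of `A` lying in
   `Ker f` are in natural bijection with `Hom_{K-alg}(H, R')` (`Hom.kerPtEquiv`; `Ker f ≅ Spec H`).
2. *Hopf algebra.* Transporting the group structure of `Ker f (Spec R') ≤ A(Spec R')` (Mathlib's
   `Hom.group` on points of the group scheme `A`) along these bijections gives a functorial group law
   on `R' ↦ Hom_{K-alg}(H, R')` (`Hom.kerGroupLaw`), whence, by the Yoneda dictionary of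
   `CorepGroupLaw` (Görtz–Wedhorn II, §(27.2)), a commutative and cocommutative Hopf algebra structure
   on `H` for which the points of `Ker f` multiply by convolution.
3. *Deligne.* By Deligne's theorem (`Literature.NumberTheory.DiophantineGeometry.Deligne.convPow_finrank_eq_one`, Görtz–Wedhorn II,
   Prop. 27.86) every `R'`-valued point of `Ker f` has order dividing `n = dim_K H`; in particular the
   universal point `Ker f → A` (over `R' = H`) satisfies `u ^ n = 1`, and every `T`-valued point of
   `Ker f`, `T` an arbitrary `K`-scheme, factors through the universal one. Since `[n]_A` acts on
   `T`-points as `x ↦ x ^ n` (`comp_nsmul_id`), this is `Ker f (T) ≤ A[n](T)`.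

## Main statements

* `Literature.AlgebraicGeometry.Motives.AbelianVariety.Hom.kerPtEquiv`: `Ker f (Spec R') ≃ Hom_{K-alg}(Γ(Ker f, 𝒪), R')`, natural in
  the commutative `K`-algebra `R'` (`Hom.kerPtEquiv_comap`).
* `Literature.AlgebraicGeometry.Motives.AbelianVariety.Hom.kerGroupLaw` and the Hopf algebra instance on `Γ(Ker f, 𝒪)`.
* `Literature.AlgebraicGeometry.Motives.AbelianVariety.IsIsogeny.kerPoints_le_kerPoints_nsmul`: `Ker f ⊆ A[deg f]`,
  `deg f = Hom.kerRank f = dim_K Γ(Ker f, 𝒪)`.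
* `Literature.AlgebraicGeometry.Motives.AbelianVariety.IsIsogeny.exists_kerPoints_le_nsmul_holds`: discharges the named fact
  `IsIsogeny.exists_kerPoints_le_nsmul` of `AVIsogenyQuasiInverse`.
* `Literature.AlgebraicGeometry.Motives.AbelianVariety.IsIsogeny.exists_nsmul_inverse_holds`: **every isogeny of abelian varieties
  has a quasi-inverse** (discharges `IsIsogeny.exists_nsmul_inverse` of `AVIsogenyTate`).

## Design notes

* Reused from the tree (`Literature.AlgebraicGeometry.Motives.AbelianVarietyTorsion`): the
  factorisation `Hom.kerPointsLift` of a point of `Ker f (T)` through the scheme `Ker f` and its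
  inverse `Hom.kerPointsOfHom`; the structure map `algebraMapΓ (Hom.kerToSpec f) : K → Γ(Ker f, 𝒪)`
  and `isoSpec_hom_comp_SpecMap_algebraMapΓ`; the bijections `specHomEquivUnderHom` (`R'`-points of
  an affine `K`-scheme `↔` ring maps under `K`) and `underHomEquivAlgHom` (ring maps under `K` `↔`
  `K`-algebra maps); `Hom.kerRank_eq_finrank`. The bijection of item 1 is literally the composite
  `Hom.kerPointsEquivSpec ≫ specHomEquivUnderHom ≫ underHomEquivAlgHom`, where
  `Hom.kerPointsEquivSpec f R'` is `Hom.kerPointsEquiv f L` of that file with its hypothesis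
  "`L` a field" relaxed to "`R'` a commutative `K`-algebra" (same construction; the group law needs
  `R' = Γ(Ker f, 𝒪) ⊗ Γ(Ker f, 𝒪)`, which is not a field): `Hom.kerPointsEquivSpec_eq_kerPointsEquiv`.
* `Hom.KerAlg f` is an `abbrev` for the carrier of `Γ(Ker f, ⊤)` carrying the `K`-algebra instance
  `(algebraMapΓ (Hom.kerToSpec f)).hom.toAlgebra` — by `rfl` the structure that `AbelianVarietyTorsion`
  introduces locally with `letI` (`Hom.kerRank_eq_finrank`, `natCard_kerPoints_eq_kerRank`), so that
  `Module.finrank K (KerAlg f) = Hom.kerRank f` (`Hom.finrank_kerAlg_eq_kerRank`) — and the Hopf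
  algebra instance of item 2 (which needs `[IsFinite (Hom.toSchemeHom f)]`, for affineness of
  `Ker f`). The only `Algebra` instances on rings of sections of schemes in Mathlib are
  `Algebra R Γ(Spec R, U)` (`AffineScheme`), `StructureSheaf.openAlgebra` and
  `ΓRestrictAlgebra : Algebra Γ(X, ⊤) Γ(U, ⊤)` for `U : X.Opens` (`Restrict`), none of which has the
  shape `Algebra K Γ(Ker f, ⊤)` (`Ker f` is a fibre product, not syntactically a `Spec`), and the
  tree declares none; so no instance is overridden and no diamond arises.
* `Literature.AlgPoints.specOverMapOfAlgHom ψ : specOver K R'' ⟶ specOver K R'` (`Spec` of a `K`-algebra map,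
  needed for naturality in `R'`) lives in the namespace `Literature.AlgebraicGeometry.Motives.AlgPoints` of its two special cases
  already in the tree, `AlgPoints.specOverMap L L'` (`AVGaloisModule`) and `AlgPoints.specMap σ`
  (`AlgPoints`), which are instances of it by `rfl` (`specOverMap_eq_specOverMapOfAlgHom`,
  `specMap_eq_specOverMapOfAlgHom`), so that a librarian can retire them.
* `[n]_A` is `n • 𝟙 A` with `n : ℕ` here (as in the named facts of `AVIsogenyQuasiInverse`);
  `hom_nsmul`/`comp_nsmul_id` are the `ℕ`-analogues of `hom_zsmul_id` (`n : ℤ`) of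
  `AbelianVarietyTorsion`.
* Mathlib searched and used: `Spec.preimage`, `Spec.map_preimage`, `Spec.map_injective`,
  `Scheme.Hom.finite_appTop`, `isAffine_of_isAffineHom`, `MonObj.comp_pow`, `Mon.Hom.hom_pow`,
  `Grp.Hom.hom_pow`, `Module.finrank_pos`, `AlgHom.coe_ringHom_injective`. Mathlib relates group
  objects and commutative Hopf algebras inside the cartesian monoidal category `(CommAlgCat R)ᵒᵖ`
  (`CommAlgCat.grpObjOpOf`, the instance `(A : (CommAlgCat R)ᵒᵖ) [GrpObj A] : HopfAlgebra R A.unop`,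
  and `GrpObj.ofRepresentableBy` for group structures on representable presheaves); what it does not
  have at this pin is the kernel of a homomorphism of group schemes as a scheme, nor a link between
  (closed subgroup schemes of) group objects in `Over (Spec K)` and Hopf algebras. Items 1–2 above
  supply exactly this link for `Ker f`, in the unbundled form `CorepGroupLaw` expects.

## References

* U. Görtz, T. Wedhorn, *Algebraic Geometry II* (2023): (27.1.1) (kernels, PDF p. 800 of the held
  copy), §(27.2) (Hopf algebras, PDF pp. 800–801), (27.35.1)–(27.35.2) (`[n]_X` and `X[n]`,
  PDF p. 886), Prop. 27.54 (PDF p. 821), Prop. 27.86 (Deligne, PDF pp. 835–836), Cor. 27.177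
  (PDF p. 882), Prop. 27.178 (PDF p. 883), Prop. 27.190 and its proof (PDF p. 889). The PDF page
  numbers refer to the held (reflowed, 1246 pp.) copy; the printed pages of the sections concerned,
  from its table of contents, are: §(27.1) *General facts on group schemes* p. 604, §(27.2) *Affine
  group schemes and Hopf algebras* p. 606 (cocommutativity: p. 607), §(27.8) *Digression:
  Fppf-surjective morphisms* (Prop. 27.54) p. 620, §(27.14) *Annihilation of commutative finite
  locally free group schemes* (Prop. 27.86) p. 633, §(27.33) *Isogenies* (Cor. 27.177, Prop. 27.178)
  p. 670, §(27.35) *Torsion points* ((27.35.1), Prop. 27.190) pp. 673–676.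
* D. Mumford, *Abelian Varieties* (1970), §19, Remark p. 169 (the cited source of the target fact;
  not held — the proof formalised here follows Görtz–Wedhorn).
* J. Tate, F. Oort, *Group schemes of prime order*, Ann. Sci. ÉNS 3 (1970), §1 (Deligne's theorem).
-/

universe u

open CategoryTheory CategoryTheory.Limits AlgebraicGeometry MonoidalCategory TensorProduct WithConv

noncomputable section

namespace Literature.NumberTheory.DiophantineGeometry

/-! ### `Spec` of a `K`-algebra homomorphism as a morphism of `K`-schemes -/

section AlgPoints
open Literature.AlgebraicGeometry.Motives (AlgPoints)
open Literature.AlgebraicGeometry.Motives.AlgPoints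

variable {K : Type u} [CommRing K] {R' R'' : Type u} [CommRing R'] [Algebra K R'] [CommRing R'']
  [Algebra K R'']

/-- `Spec` of a `K`-algebra homomorphism `ψ : R' → R''` of commutative `K`-algebras, as a morphism
of `K`-schemes `Spec R'' → Spec R'` (Hartshorne, *Algebraic Geometry*, II.2, Prop. 2.3). The special
cases already in the tree, `AlgPoints.specOverMap L L'` (a tower of fields `k → L → L'`,
`AVGaloisModule`) and `AlgPoints.specMap σ` (`σ : L ≃ₐ[k] L`, `AlgPoints`), are instances of it by
`rfl` (`specOverMap_eq_specOverMapOfAlgHom`, `specMap_eq_specOverMapOfAlgHom`); it is declared in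
their namespace `Literature.AlgebraicGeometry.Motives.AlgPoints` on purpose. Used below with `ψ` an arbitrary `K`-algebra map, for
naturality in the `K`-algebra `R'`. [folklore] -/
def _root_.Literature.AlgebraicGeometry.Motives.AlgPoints.specOverMapOfAlgHom (ψ : R' →ₐ[K] R'') : Literature.AlgebraicGeometry.Motives.specOver K R'' ⟶ Literature.AlgebraicGeometry.Motives.specOver K R' :=
  Over.homMk (Spec.map (CommRingCat.ofHom ψ.toRingHom)) (by
    change Spec.map (CommRingCat.ofHom ψ.toRingHom) ≫
        Spec.map (CommRingCat.ofHom (algebraMap K R')) =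
      Spec.map (CommRingCat.ofHom (algebraMap K R''))
    rw [← Spec.map_comp]
    congr 1
    ext c
    exact ψ.commutes c)

/-- The underlying scheme morphism of `specOverMapOfAlgHom ψ` is `Spec ψ` (Hartshorne II.2,
Prop. 2.3). [folklore] -/
@[simp]
theorem _root_.Literature.AlgebraicGeometry.Motives.AlgPoints.specOverMapOfAlgHom_left (ψ : R' →ₐ[K] R'') :
    (specOverMapOfAlgHom ψ).left = Spec.map (CommRingCat.ofHom ψ.toRingHom) :=
  rfl

/-- `AlgPoints.specOverMap L L'` (`AVGaloisModule`) is `specOverMapOfAlgHom` of the `k`-algebra map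
`L → L'` of the tower (bridge lemma, so that the special case can be retired). [folklore] -/
theorem _root_.Literature.AlgebraicGeometry.Motives.AlgPoints.specOverMap_eq_specOverMapOfAlgHom {k : Type u} [Field k] (L L' : Type u) [Field L]
    [Algebra k L] [Field L'] [Algebra k L'] [Algebra L L'] [IsScalarTower k L L'] :
    specOverMap L L' = specOverMapOfAlgHom (IsScalarTower.toAlgHom k L L') :=
  rfl

/-- `AlgPoints.specMap σ` (`AlgPoints`) is `specOverMapOfAlgHom (σ : L →ₐ[k] L)` (bridge lemma).
[folklore] -/
theorem _root_.Literature.AlgebraicGeometry.Motives.AlgPoints.specMap_eq_specOverMapOfAlgHom {k : Type u} [Field k] {L : Type u} [Field L] [Algebra k L]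
    (σ : L ≃ₐ[k] L) : specMap σ = specOverMapOfAlgHom (σ : L →ₐ[k] L) :=
  rfl

end AlgPoints

section AbelianVariety
open Literature.AlgebraicGeometry.Motives (AbelianVariety)
open Literature.AlgebraicGeometry.Motives.AbelianVariety

open scoped MonObj

open Hom Literature.AlgebraicGeometry.Motives.AbelianVariety.Hom

variable {K : Type u} [Field K] {A B : AbelianVariety K}

/-! ### Multiplication by `n` on points -/

section Nsmul

/-- The additive structure on `Hom(A, B)` is the transported pointwise group structure:
`(n • g).hom = g.hom ^ n` (`ℕ`-analogue of `hom_zsmul_id`). [folklore] -/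
theorem _root_.Literature.AlgebraicGeometry.Motives.AbelianVariety.hom_nsmul (n : ℕ) (g : A ⟶ B) : (n • g).hom = g.hom ^ n := rfl

/-- `[n]_A` acts on `T`-valued points as `x ↦ x ^ n` (Görtz–Wedhorn II, (27.35.1), PDF p. 886:
`X(T) ∋ x ↦ nx ∈ X(T)`). [folklore] -/
theorem _root_.Literature.AlgebraicGeometry.Motives.AbelianVariety.comp_nsmul_id {T : Literature.AlgebraicGeometry.Motives.SchemeOver K} (x : T ⟶ A.X) (n : ℕ) :
    x ≫ (n • 𝟙 A).hom.hom.hom = x ^ n := by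
  rw [hom_nsmul, Grp.Hom.hom_pow, Mon.Hom.hom_pow, MonObj.comp_pow, id_hom]
  rfl

/-- `x ∈ Ker [n]_A (T) ↔ x ^ n = 1`: the kernel of `[n]_A` on `T`-points is the `n`-torsion
`A[n](T)` (Görtz–Wedhorn II, (27.35.2) `X[n] := Ker [n]`, PDF p. 886, with (27.1.1),
`Ker(f)(T) = Ker(f(T))`, PDF p. 800; compare `torsionPoints_eq_kerPoints` for `n : ℤ`). [folklore] -/
theorem _root_.Literature.AlgebraicGeometry.Motives.AbelianVariety.mem_kerPoints_nsmul_iff {T : Literature.AlgebraicGeometry.Motives.SchemeOver K} (n : ℕ) (x : T ⟶ A.X) :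
    x ∈ kerPoints T (n • 𝟙 A) ↔ x ^ n = 1 := by
  rw [mem_kerPoints_iff, comp_nsmul_id]

end Nsmul

/-! ### `Ker f` as a `K`-scheme and its universal point -/

section KerScheme

variable (f : A ⟶ B)

/-- `Ker f` as a `K`-scheme, with structure morphism `Ker f → Spec K`. [folklore] -/
abbrev _root_.Literature.AlgebraicGeometry.Motives.AbelianVariety.Hom.kerOver : Literature.AlgebraicGeometry.Motives.SchemeOver K := Over.mk (Hom.kerToSpec f)

/-- The universal point of the kernel: the inclusion `Ker f → A` as a `Ker f`-valued point of `A`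
over `K` (the left vertical arrow of Görtz–Wedhorn II, (27.1.1), PDF p. 800). [folklore] -/
def _root_.Literature.AlgebraicGeometry.Motives.AbelianVariety.Hom.kerUnivPt : kerOver f ⟶ A.X := Over.homMk (Hom.kerι f) (Hom.kerι_comp_hom f)

/-- The universal point lies in `Ker f (Ker f)`. [folklore] -/
theorem _root_.Literature.AlgebraicGeometry.Motives.AbelianVariety.Hom.kerUnivPt_mem : kerUnivPt f ∈ kerPoints (kerOver f) f := by
  rw [mem_kerPoints_iff]
  refine Over.OverMorphism.ext ?_
  change Hom.kerι f ≫ Hom.toSchemeHom f = (kerOver f).hom ≫ unitPt B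
  rw [Hom.kerι_comp_toSchemeHom, Hom.kerι_comp_hom]
  rfl

variable {f} {T T' : Literature.AlgebraicGeometry.Motives.SchemeOver K}

variable (f) in
/-- Precomposition with `g : T' → T` maps `Ker f (T)` to `Ker f (T')`, as a homomorphism of groups
(functoriality of `Ker(f)(T) = Ker(f(T))` in `T`; Görtz–Wedhorn II, (27.1.1), PDF p. 800).
[folklore] -/
def _root_.Literature.AlgebraicGeometry.Motives.AbelianVariety.Hom.kerPointsComap (g : T' ⟶ T) : kerPoints T f →* kerPoints T' f where
  toFun x := ⟨g ≫ x.1, by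
    rw [mem_kerPoints_iff, Category.assoc, (mem_kerPoints_iff _ _).mp x.2, MonObj.comp_one]⟩
  map_one' := Subtype.ext (MonObj.comp_one g)
  map_mul' x y := Subtype.ext (MonObj.comp_mul g x.1 y.1)

/-- `kerPointsComap g x = g ≫ x` on underlying points. [folklore] -/
@[simp]
theorem _root_.Literature.AlgebraicGeometry.Motives.AbelianVariety.Hom.coe_kerPointsComap (g : T' ⟶ T) (x : kerPoints T f) :
    (kerPointsComap f g x : T' ⟶ A.X) = g ≫ x :=
  rfl

/-- The factorisation `Hom.kerPointsLift` (from `AbelianVarietyTorsion`) of points of `Ker f (T)`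
through the scheme `Ker f` is natural in `T`. [folklore] -/
theorem _root_.Literature.AlgebraicGeometry.Motives.AbelianVariety.Hom.kerPointsLift_comap (g : T' ⟶ T) (P : kerPoints T f) :
    kerPointsLift f (kerPointsComap f g P) = g.left ≫ kerPointsLift f P :=
  pullback.hom_ext (by simp) (by simp)

/-- The factorisation of `P ∈ Ker f (T)` through `Ker f`, as a morphism of `K`-schemes `T → Ker f`.
[folklore] -/
def _root_.Literature.AlgebraicGeometry.Motives.AbelianVariety.Hom.kerLiftOver (P : kerPoints T f) : T ⟶ kerOver f :=
  Over.homMk (kerPointsLift f P) (kerPointsLift_kerToSpec f P)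

/-- **Every point of `Ker f (T)` factors through the universal point.** [folklore] -/
@[reassoc]
theorem _root_.Literature.AlgebraicGeometry.Motives.AbelianVariety.Hom.kerLiftOver_comp_kerUnivPt (x : T ⟶ A.X) (hx : x ∈ kerPoints T f) :
    kerLiftOver ⟨x, hx⟩ ≫ kerUnivPt f = x :=
  Over.OverMorphism.ext (kerPointsLift_kerι f ⟨x, hx⟩)

/-- The point of `Ker f (T)` defined by `g : T → Ker f` over `K` (`Hom.kerPointsOfHom`, from
`AbelianVarietyTorsion`) is `g` followed by the universal point. [folklore] -/
theorem _root_.Literature.AlgebraicGeometry.Motives.AbelianVariety.Hom.coe_kerPointsOfHom (g : T.left ⟶ Hom.ker f) (hg : g ≫ kerToSpec f = T.hom) :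
    (kerPointsOfHom f g hg : T ⟶ A.X) = (Over.homMk g hg : T ⟶ kerOver f) ≫ kerUnivPt f :=
  rfl

/-- `Hom.kerPointsOfHom` only depends on the morphism `T → Ker f`. [folklore] -/
theorem _root_.Literature.AlgebraicGeometry.Motives.AbelianVariety.Hom.kerPointsOfHom_congr {g g' : T.left ⟶ Hom.ker f} (h : g = g')
    {hg : g ≫ kerToSpec f = T.hom} {hg' : g' ≫ kerToSpec f = T.hom} :
    kerPointsOfHom f g hg = kerPointsOfHom f g' hg' := by
  subst h
  rfl

/-- `kerPointsLift (kerPointsOfHom g) = g`. [folklore] -/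
@[simp]
theorem _root_.Literature.AlgebraicGeometry.Motives.AbelianVariety.Hom.kerPointsLift_kerPointsOfHom (g : T.left ⟶ Hom.ker f)
    (hg : g ≫ kerToSpec f = T.hom) : kerPointsLift f (kerPointsOfHom f g hg) = g :=
  pullback.hom_ext (kerPointsLift_kerι f _) (by rw [kerPointsLift_kerToSpec, hg])

/-- `kerPointsOfHom (kerPointsLift P) = P`. [folklore] -/
@[simp]
theorem _root_.Literature.AlgebraicGeometry.Motives.AbelianVariety.Hom.kerPointsOfHom_kerPointsLift (P : kerPoints T f) :
    kerPointsOfHom f (kerPointsLift f P) (kerPointsLift_kerToSpec f P) = P :=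
  Subtype.ext (Over.OverMorphism.ext (kerPointsLift_kerι f P))

end KerScheme

/-! ### The affine algebra of the kernel and its points -/

section KerAlg

variable (f : A ⟶ B)

/-- The affine algebra `H_f = Γ(Ker f, 𝒪)` of the scheme-theoretic kernel of `f`; for `f` an isogeny,
`Ker f = Spec H_f` is a finite `K`-group scheme of order `dim_K H_f = Hom.kerRank f = deg f`
(Görtz–Wedhorn II, Cor. 27.177). [folklore] -/
abbrev _root_.Literature.AlgebraicGeometry.Motives.AbelianVariety.Hom.KerAlg : Type u := Γ(Hom.ker f, ⊤)

/-- `Γ(Ker f, 𝒪)` is a `K`-algebra through `algebraMapΓ (Ker f → Spec K) : K ≅ Γ(Spec K, 𝒪) → Γ(Ker f, 𝒪)`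
(the structure used locally, via `letI`, in `Hom.kerRank_eq_finrank`). [folklore] -/
instance _root_.Literature.AlgebraicGeometry.Motives.AbelianVariety.Hom.KerAlg.instAlgebra : Algebra K (KerAlg f) :=
  (Literature.AlgebraicGeometry.Motives.algebraMapΓ (Hom.kerToSpec f)).hom.toAlgebra

/-- Unfolding the `K`-algebra structure of `Γ(Ker f, 𝒪)`. [folklore] -/
theorem _root_.Literature.AlgebraicGeometry.Motives.AbelianVariety.Hom.KerAlg.algebraMap_eq :
    algebraMap K (KerAlg f) = (Literature.AlgebraicGeometry.Motives.algebraMapΓ (Hom.kerToSpec f)).hom :=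
  rfl

/-- `dim_K Γ(Ker f, 𝒪) = Hom.kerRank f` (the latter, from `AVIsogenyFlat`, is this dimension taken
over `Γ(Spec K, 𝒪) ≅ K`; `Hom.kerRank_eq_finrank`). [folklore] -/
theorem _root_.Literature.AlgebraicGeometry.Motives.AbelianVariety.Hom.finrank_kerAlg_eq_kerRank : Module.finrank K (KerAlg f) = kerRank f :=
  (kerRank_eq_finrank f).symm

/-- `Γ(Ker f, 𝒪)` is a nontrivial ring: `Ker f` has a `K`-point (the unit), so `Γ(Ker f, 𝒪)` maps to
the nonzero ring `Γ(Spec K, 𝒪) ≅ K`. [folklore] -/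
instance _root_.Literature.AlgebraicGeometry.Motives.AbelianVariety.Hom.KerAlg.nontrivial : Nontrivial (KerAlg f) :=
  ((kerPointsLift f ⟨(1 : Literature.AlgebraicGeometry.Motives.specOver K K ⟶ A.X), one_mem_kerPoints f⟩).appTop ≫
    (Scheme.ΓSpecIso (.of K)).hom).hom.domain_nontrivial

variable {f} {R' R'' : Type u} [CommRing R'] [Algebra K R'] [CommRing R''] [Algebra K R'']

/-- `Hom.kerPointsLift` is natural in the `K`-algebra `R'`. [folklore] -/
theorem _root_.Literature.AlgebraicGeometry.Motives.AbelianVariety.Hom.kerPointsLift_comap_specOverMapOfAlgHom (ψ : R' →ₐ[K] R'')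
    (P : kerPoints (Literature.AlgebraicGeometry.Motives.specOver K R') f) :
    kerPointsLift f (kerPointsComap f (Literature.AlgebraicGeometry.Motives.AlgPoints.specOverMapOfAlgHom ψ) P) =
      Spec.map (CommRingCat.ofHom ψ.toRingHom) ≫ kerPointsLift f P :=
  kerPointsLift_comap (Literature.AlgebraicGeometry.Motives.AlgPoints.specOverMapOfAlgHom ψ) P

variable (f R') in
/-- **`Ker f (Spec R') = (Ker f)(Spec R')`** for a commutative `K`-algebra `R'`: the `Spec R'`-valued
points of `A` over `K` killed by `f` are the `Spec R'`-valued points over `K` of the kernel scheme.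
This is `Hom.kerPointsEquiv f L` of `AbelianVarietyTorsion` (stated there for a field `L`) with the
same construction for an arbitrary commutative `K`-algebra `R'`, as needed below for
`R' = Γ(Ker f, 𝒪)` and its tensor powers (Görtz–Wedhorn II, (27.1.1), PDF p. 800). [folklore] -/
def _root_.Literature.AlgebraicGeometry.Motives.AbelianVariety.Hom.kerPointsEquivSpec :
    kerPoints (Literature.AlgebraicGeometry.Motives.specOver K R') f ≃
      {x : Spec (.of R') ⟶ Hom.ker f //
        x ≫ kerToSpec f = Spec.map (CommRingCat.ofHom (algebraMap K R'))} where
  toFun P := ⟨kerPointsLift f P, kerPointsLift_kerToSpec f P⟩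
  invFun x := kerPointsOfHom f x.1 x.2
  left_inv P := kerPointsOfHom_kerPointsLift P
  right_inv x := Subtype.ext (kerPointsLift_kerPointsOfHom (T := Literature.AlgebraicGeometry.Motives.specOver K R') x.1 x.2)

/-- Over a field `L ⊇ K`, `Hom.kerPointsEquivSpec f L` is `Hom.kerPointsEquiv f L` of
`AbelianVarietyTorsion`. [folklore] -/
theorem _root_.Literature.AlgebraicGeometry.Motives.AbelianVariety.Hom.kerPointsEquivSpec_eq_kerPointsEquiv (L : Type u) [Field L] [Algebra K L] :
    kerPointsEquivSpec f L = kerPointsEquiv f L :=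
  rfl

variable [IsFinite (Hom.toSchemeHom f)]

variable (f) in
/-- The kernel of a homomorphism with finite underlying morphism is an affine scheme. [folklore] -/
instance _root_.Literature.AlgebraicGeometry.Motives.AbelianVariety.Hom.ker.isAffine : IsAffine (Hom.ker f) := isAffine_of_isAffineHom (Hom.kerToSpec f)

variable (f) in
/-- `Γ(Ker f, 𝒪)` is a finite `K`-algebra when `f` is finite (Görtz–Wedhorn II, Cor. 27.177).
[folklore] -/
instance _root_.Literature.AlgebraicGeometry.Motives.AbelianVariety.Hom.KerAlg.moduleFinite : Module.Finite K (KerAlg f) := by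
  have h1 : (kerToSpec f).appTop.hom.Finite := (kerToSpec f).finite_appTop
  have h2 : (Scheme.ΓSpecIso (.of K)).inv.hom.Finite :=
    RingHom.Finite.of_surjective _ fun y ↦ ⟨(Scheme.ΓSpecIso (.of K)).hom.hom y, by
      rw [← CommRingCat.comp_apply, Iso.hom_inv_id, CommRingCat.id_apply]⟩
  exact h1.comp h2

variable (f) in
/-- `0 < Hom.kerRank f` for `f` finite: `Γ(Ker f, 𝒪)` is a nonzero finite-dimensional `K`-algebra.
[folklore] -/
theorem _root_.Literature.AlgebraicGeometry.Motives.AbelianVariety.Hom.kerRank_pos : 0 < kerRank f := by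
  rw [← finrank_kerAlg_eq_kerRank]
  exact Module.finrank_pos

variable (f R') in
/-- **Points of the kernel.** For a commutative `K`-algebra `R'`, the `Spec R'`-valued points of `A`
lying in `Ker f` are in bijection with `Hom_{K-alg}(Γ(Ker f, 𝒪), R')`, since `Ker f ≅ Spec Γ(Ker f, 𝒪)`
is affine (Görtz–Wedhorn II, (27.1.1) and §(27.2), PDF p. 800): the composite of
`Hom.kerPointsEquivSpec`, `specHomEquivUnderHom` and `underHomEquivAlgHom`. [folklore] -/
def _root_.Literature.AlgebraicGeometry.Motives.AbelianVariety.Hom.kerPtEquiv : kerPoints (Literature.AlgebraicGeometry.Motives.specOver K R') f ≃ (KerAlg f →ₐ[K] R') :=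
  (kerPointsEquivSpec f R').trans <|
    (Literature.AlgebraicGeometry.Motives.specHomEquivUnderHom (Hom.kerToSpec f) R').trans
      (Literature.AlgebraicGeometry.Motives.underHomEquivAlgHom (Literature.AlgebraicGeometry.Motives.algebraMapΓ (Hom.kerToSpec f)) R')

/-- The ring homomorphism underlying `kerPtEquiv f R' P` is `Γ` of `Spec R' → Ker f ≅ Spec Γ(Ker f, 𝒪)`
(as `Spec.preimage`). [folklore] -/
theorem _root_.Literature.AlgebraicGeometry.Motives.AbelianVariety.Hom.ofHom_kerPtEquiv (P : kerPoints (Literature.AlgebraicGeometry.Motives.specOver K R') f) :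
    CommRingCat.ofHom (kerPtEquiv f R' P).toRingHom =
      Spec.preimage (kerPointsLift f P ≫ (Hom.ker f).isoSpec.hom) :=
  rfl

/-- Naturality of `kerPtEquiv` in `R'`, on underlying morphisms of `CommRingCat`. [folklore] -/
theorem _root_.Literature.AlgebraicGeometry.Motives.AbelianVariety.Hom.preimage_kerPointsLift_comap (ψ : R' →ₐ[K] R'') (P : kerPoints (Literature.AlgebraicGeometry.Motives.specOver K R') f) :
    Spec.preimage (kerPointsLift f (kerPointsComap f (Literature.AlgebraicGeometry.Motives.AlgPoints.specOverMapOfAlgHom ψ) P) ≫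
        (Hom.ker f).isoSpec.hom) =
      Spec.preimage (kerPointsLift f P ≫ (Hom.ker f).isoSpec.hom) ≫
        CommRingCat.ofHom ψ.toRingHom := by
  apply Spec.map_injective
  simp only [Spec.map_comp, Spec.map_preimage, Category.assoc,
    kerPointsLift_comap_specOverMapOfAlgHom]

/-- **Naturality of `kerPtEquiv`** in the `K`-algebra `R'`. [folklore] -/
theorem _root_.Literature.AlgebraicGeometry.Motives.AbelianVariety.Hom.kerPtEquiv_comap (ψ : R' →ₐ[K] R'') (P : kerPoints (Literature.AlgebraicGeometry.Motives.specOver K R') f) :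
    kerPtEquiv f R'' (kerPointsComap f (Literature.AlgebraicGeometry.Motives.AlgPoints.specOverMapOfAlgHom ψ) P) =
      ψ.comp (kerPtEquiv f R' P) := by
  apply AlgHom.coe_ringHom_injective
  change (Spec.preimage (kerPointsLift f (kerPointsComap f (Literature.AlgebraicGeometry.Motives.AlgPoints.specOverMapOfAlgHom ψ) P) ≫
      (Hom.ker f).isoSpec.hom)).hom =
    (Spec.preimage (kerPointsLift f P ≫ (Hom.ker f).isoSpec.hom) ≫
      CommRingCat.ofHom ψ.toRingHom).hom
  rw [preimage_kerPointsLift_comap]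

variable (f) in
/-- **The functorial group law on the points of `Spec Γ(Ker f, 𝒪) ≅ Ker f`**, transported from the
group structure of `Ker f (Spec R') ≤ A(Spec R')` along `kerPtEquiv` (Görtz–Wedhorn II, §(27.2) and
(27.1.1), PDF p. 800: the kernel is a subgroup functor). [folklore] -/
def _root_.Literature.AlgebraicGeometry.Motives.AbelianVariety.Hom.kerGroupLaw : CorepGroupLaw K (KerAlg f) where
  mul := fun R' _ _ φ χ ↦ kerPtEquiv f R' ((kerPtEquiv f R').symm φ * (kerPtEquiv f R').symm χ)
  one := fun R' _ _ ↦ kerPtEquiv f R' 1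
  inv := fun R' _ _ φ ↦ kerPtEquiv f R' ((kerPtEquiv f R').symm φ)⁻¹
  mul_assoc x y z := by simp only [Equiv.symm_apply_apply, mul_assoc]
  one_mul x := by simp only [Equiv.symm_apply_apply, one_mul, Equiv.apply_symm_apply]
  inv_mul x := by simp only [Equiv.symm_apply_apply, inv_mul_cancel]
  comp_mul ψ x y := by
    obtain ⟨a, rfl⟩ := (kerPtEquiv f _).surjective x
    obtain ⟨b, rfl⟩ := (kerPtEquiv f _).surjective y
    simp only [Equiv.symm_apply_apply, ← kerPtEquiv_comap, map_mul]
  comp_one ψ := by rw [← kerPtEquiv_comap, map_one]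

/-- The product of the group law is the product of points of `A`. [folklore] -/
theorem _root_.Literature.AlgebraicGeometry.Motives.AbelianVariety.Hom.kerGroupLaw_mul_apply (x y : kerPoints (Literature.AlgebraicGeometry.Motives.specOver K R') f) :
    (kerGroupLaw f).mul (kerPtEquiv f R' x) (kerPtEquiv f R' y) = kerPtEquiv f R' (x * y) := by
  change kerPtEquiv f R' ((kerPtEquiv f R').symm (kerPtEquiv f R' x) *
    (kerPtEquiv f R').symm (kerPtEquiv f R' y)) = _
  rw [Equiv.symm_apply_apply, Equiv.symm_apply_apply]

variable (R') in
/-- The unit of the group law is the unit point of `A`. [folklore] -/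
theorem _root_.Literature.AlgebraicGeometry.Motives.AbelianVariety.Hom.kerGroupLaw_one : (kerGroupLaw f).one R' = kerPtEquiv f R' 1 := rfl

variable (f) in
/-- **The Hopf algebra of the kernel.** `Γ(Ker f, 𝒪)` is a commutative Hopf `K`-algebra, `Ker f`
being a (finite) `K`-group scheme (Görtz–Wedhorn II, §(27.2) and Cor. 27.177). [folklore] -/
instance _root_.Literature.AlgebraicGeometry.Motives.AbelianVariety.Hom.KerAlg.instHopfAlgebra : HopfAlgebra K (KerAlg f) := (kerGroupLaw f).toHopfAlgebra

variable (f) in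
/-- The Hopf algebra `Γ(Ker f, 𝒪)` is cocommutative, `A` being commutative
(Görtz–Wedhorn II, §(27.2), PDF p. 801 = printed p. 607). [folklore] -/
instance _root_.Literature.AlgebraicGeometry.Motives.AbelianVariety.Hom.KerAlg.isCocomm : Coalgebra.IsCocomm K (KerAlg f) :=
  (kerGroupLaw f).isCocomm fun x y ↦ by
    obtain ⟨a, rfl⟩ := (kerPtEquiv f _).surjective x
    obtain ⟨b, rfl⟩ := (kerPtEquiv f _).surjective y
    rw [kerGroupLaw_mul_apply, kerGroupLaw_mul_apply, mul_comm]

variable (f R') in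
/-- **Points of `Ker f` multiply by convolution**: the injective homomorphism of monoids
`Ker f (Spec R') → (Hom_{K-alg}(Γ(Ker f, 𝒪), R'), ⋆)` into Mathlib's convolution monoid.
[folklore] -/
def _root_.Literature.AlgebraicGeometry.Motives.AbelianVariety.Hom.kerPtConv : kerPoints (Literature.AlgebraicGeometry.Motives.specOver K R') f →* WithConv (KerAlg f →ₐ[K] R') where
  toFun u := toConv (kerPtEquiv f R' u)
  map_one' := by
    change toConv ((kerGroupLaw f).one R') = 1
    exact (kerGroupLaw f).toConv_one
  map_mul' u v := by
    change toConv (kerPtEquiv f R' (u * v)) = toConv (kerPtEquiv f R' u) * toConv (kerPtEquiv f R' v)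
    rw [← kerGroupLaw_mul_apply]
    exact (kerGroupLaw f).toConv_mul _ _

/-- `kerPtConv u = toConv (kerPtEquiv u)`. [folklore] -/
theorem _root_.Literature.AlgebraicGeometry.Motives.AbelianVariety.Hom.kerPtConv_apply (u : kerPoints (Literature.AlgebraicGeometry.Motives.specOver K R') f) :
    kerPtConv f R' u = toConv (kerPtEquiv f R' u) :=
  rfl

variable (f R') in
/-- `kerPtConv` is injective. [folklore] -/
theorem _root_.Literature.AlgebraicGeometry.Motives.AbelianVariety.Hom.kerPtConv_injective : Function.Injective (kerPtConv f R') := fun _ _ h ↦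
  (kerPtEquiv f R').injective (WithConv.toConv_injective h)

/-- **Deligne's theorem for the kernel**: every `Spec R'`-valued point `u` of `Ker f` satisfies
`u ^ n = 1` in `A(Spec R')`, where `n = Hom.kerRank f = dim_K Γ(Ker f, 𝒪)` is the order of `Ker f`
(Görtz–Wedhorn II, Prop. 27.86, via `Literature.NumberTheory.DiophantineGeometry.Deligne.convPow_finrank_eq_one`).
[cite: GortzWedhorn2023, Prop. 27.86] -/
theorem _root_.Literature.AlgebraicGeometry.Motives.AbelianVariety.Hom.kerPt_pow_kerRank (u : kerPoints (Literature.AlgebraicGeometry.Motives.specOver K R') f) : u ^ kerRank f = 1 :=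
  kerPtConv_injective f R' <| by
    rw [map_pow, map_one, ← finrank_kerAlg_eq_kerRank]
    exact Deligne.convPow_finrank_eq_one _

variable (f)

/-- `Spec Γ(Ker f, 𝒪) → Ker f` as a morphism of `K`-schemes. [folklore] -/
def _root_.Literature.AlgebraicGeometry.Motives.AbelianVariety.Hom.specKerAlgToKer : Literature.AlgebraicGeometry.Motives.specOver K (KerAlg f) ⟶ kerOver f :=
  Over.homMk (Hom.ker f).isoSpec.inv
    ((Iso.inv_comp_eq _).mpr (Literature.AlgebraicGeometry.Motives.isoSpec_hom_comp_SpecMap_algebraMapΓ (Hom.kerToSpec f)).symm)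

/-- `Ker f → Spec Γ(Ker f, 𝒪)` as a morphism of `K`-schemes. [folklore] -/
def _root_.Literature.AlgebraicGeometry.Motives.AbelianVariety.Hom.kerToSpecKerAlg : kerOver f ⟶ Literature.AlgebraicGeometry.Motives.specOver K (KerAlg f) :=
  Over.homMk (Hom.ker f).isoSpec.hom (Literature.AlgebraicGeometry.Motives.isoSpec_hom_comp_SpecMap_algebraMapΓ (Hom.kerToSpec f))

/-- `Ker f → Spec Γ(Ker f, 𝒪) → Ker f` is the identity. [folklore] -/
@[reassoc]
theorem _root_.Literature.AlgebraicGeometry.Motives.AbelianVariety.Hom.kerToSpecKerAlg_comp : kerToSpecKerAlg f ≫ specKerAlgToKer f = 𝟙 _ :=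
  Over.OverMorphism.ext (Hom.ker f).isoSpec.hom_inv_id

/-- **The universal point of `Ker f` has order dividing `n = Hom.kerRank f = dim_K Γ(Ker f, 𝒪)`**
(Deligne's theorem applied over `R' = Γ(Ker f, 𝒪)`; Görtz–Wedhorn II, Prop. 27.86).
[cite: GortzWedhorn2023, Prop. 27.86] -/
theorem _root_.Literature.AlgebraicGeometry.Motives.AbelianVariety.Hom.kerUnivPt_pow_kerRank : kerUnivPt f ^ kerRank f = 1 := by
  have h1 : kerUnivPt f = kerToSpecKerAlg f ≫ (specKerAlgToKer f ≫ kerUnivPt f) := by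
    rw [kerToSpecKerAlg_comp_assoc]
  have h2 : (specKerAlgToKer f ≫ kerUnivPt f) ^ kerRank f = 1 := by
    simpa using congrArg Subtype.val
      (kerPt_pow_kerRank (kerPointsComap f (specKerAlgToKer f) ⟨kerUnivPt f, kerUnivPt_mem f⟩))
  rw [h1, ← MonObj.comp_pow, h2, MonObj.comp_one]

end KerAlg

/-! ### The kernel of an isogeny is killed by its order; quasi-inverses -/

section Isogeny

/-- **The kernel of an isogeny is annihilated by its order**: for an isogeny `f : A → B` and every
`K`-scheme `T`, `Ker f (T) ≤ A[n](T)` with `n = deg f = Hom.kerRank f = dim_K Γ(Ker f, 𝒪)`, i.e.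
`Ker f ⊆ Ker [deg f]_A` scheme-theoretically (Görtz–Wedhorn II, Prop. 27.86 with Cor. 27.177, as used
in the proof of Prop. 27.190; Mumford §19, Remark p. 169). Every `T`-point of `Ker f` factors through
the universal point, which is killed by `n` (`Hom.kerUnivPt_pow_kerRank`).
[cite: GortzWedhorn2023, Prop. 27.86 and Cor. 27.177] -/
theorem _root_.Literature.AlgebraicGeometry.Motives.AbelianVariety.IsIsogeny.kerPoints_le_kerPoints_nsmul {f : A ⟶ B} (hf : IsIsogeny f) (T : Literature.AlgebraicGeometry.Motives.SchemeOver K) :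
    kerPoints T f ≤ kerPoints T (kerRank f • 𝟙 A) := by
  haveI := hf.2
  intro x hx
  rw [mem_kerPoints_nsmul_iff, ← kerLiftOver_comp_kerUnivPt x hx, ← MonObj.comp_pow,
    kerUnivPt_pow_kerRank, MonObj.comp_one]

/-- **Discharge of the named fact `IsIsogeny.exists_kerPoints_le_nsmul`** of `AVIsogenyQuasiInverse`:
the kernel of an isogeny is annihilated by a positive integer, namely by its order
`deg f = Hom.kerRank f = dim_K Γ(Ker f, 𝒪)` (Görtz–Wedhorn II, Prop. 27.86 and Cor. 27.177).
[cite: GortzWedhorn2023, Prop. 27.86 and Cor. 27.177] -/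
theorem _root_.Literature.AlgebraicGeometry.Motives.AbelianVariety.IsIsogeny.exists_kerPoints_le_nsmul_holds :
    IsIsogeny.exists_kerPoints_le_nsmul (A := A) (B := B) :=
  fun {f} hf ↦
    ⟨kerRank f, by haveI := hf.2; exact kerRank_pos f, hf.kerPoints_le_kerPoints_nsmul⟩

/-- **Every isogeny of abelian varieties has a quasi-inverse** (discharge of the named fact
`IsIsogeny.exists_nsmul_inverse` of `AVIsogenyTate`): if `f : A → B` is an isogeny there are
`g : B → A` and `n ≥ 1` with `g ∘ f = [n]_A` and `f ∘ g = [n]_B` (Mumford, *Abelian Varieties*, §19,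
Remark p. 169, with `n = deg f`; Görtz–Wedhorn II, Prop. 27.190). The proof is the printed one
(Görtz–Wedhorn II, p. 889): `Ker f` is killed by its order `n` (Deligne, Prop. 27.86;
`IsIsogeny.exists_kerPoints_le_nsmul_holds`), so `[n]_A` factors through the quotient `A → A / Ker f = B`
(faithful flatness of isogenies, Prop. 27.54, and fpqc descent; `AVIsogenyFlat`), and `f ∘ g = [n]_B`
since isogenies are epimorphisms (Prop. 27.178). [cite: MumfordAV1970, §19 Remark p. 169]
[cite: GortzWedhorn2023, Prop. 27.190] -/
theorem _root_.Literature.AlgebraicGeometry.Motives.AbelianVariety.IsIsogeny.exists_nsmul_inverse_holds : IsIsogeny.exists_nsmul_inverse (A := A) (B := B) :=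
  IsIsogeny.exists_nsmul_inverse_of_exists_kerPoints_le_nsmul
    IsIsogeny.exists_kerPoints_le_nsmul_holds

end Isogeny

end AbelianVariety

end Literature.NumberTheory.DiophantineGeometry
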